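/-
Copyright (c) 2026 the pub-hodgecm-mathlib formalisation cell (harness21).  Prover seat hodgecm-mathlib-LH4-p10 (g9) (valve hand), Track B «K2-LIT»,
#184♮ = hLiu418 = `stmt-HodgeConjecture-24832`; socket #41, KIND W, (KW-arch-hBL) brick (3a) «EXPLICIT (x-a) CHAIN, `Ew` BY VALUE» (architect K2E3-p11 (g10) FILE 3 census
2026-09-05T01:16:30Z + WORD #1 (L2); assembler K2Liu-p11 (g5) (3c) SIG (L1); KW desk F0P2-p08 (g4)).  Siblings of ★ FILE A `K2LiuKindWArchContinuation` §1–§4 (this base, g8)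
and ★ `K2LiuKindWArchContinuationBridge` §1 (R90-C10-p03) with the per-place continuations GIVEN instead of CHOSEN.  THEOREMS ONLY (no `def`, no `instance`, no notation,
no named-fact hypothesis, no `sorry`, default heartbeats).
-/
import Summits.HodgeConjecture.HodgeConjecture.Theorems.K2LiuKindWArchContinuationBridge   -- ★ p863572 (brings ★ FILE A p863282 §1–§5, ★ (iii-arch-int), ★ `K2LiuKindWArchLetterDefs`)
import HarnessLib

/-!
# Crux `HLiu418`, socket #41, KIND W, (3a): THE TWISTED ARCHIMEDEAN BLOCK IS `c(ν) · ∏_w E_w(s)` — THE (x-a) CONTINUATION CHAIN WITH THE PER-PLACE LETTERS BY VALUE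

Cell `hodgecm-mathlib`, crux item hLiu418 = `stmt-HodgeConjecture-24832` (helper lane `--supports … --as helper`, count-neutral); KW line, valve hand LH4-p10 (g9).
THE POINT.  ★ FILE A §1–§4 and ★ Bridge §1 conclude `∃ E, DifferentiableOn ℂ E {0 < re} ∧ ∀ s, s₁ < re s → ‹twisted arch block› = E s`: the witness
`E = c(ν)·∏_w Ew w` (resp. `Cst·Σ_r c_r·c(ν)·∏_w Ew r w`) is hidden behind `choose Ew` and `∃`.  The (KW-arch-hBL) GROWTH letter of ★ p863724 needs the VALUE, so this file
re-runs the same proofs with the per-place twisted Whittaker letters as INPUT FUNCTIONS `Ew` (only their FORMULA `hEwq` on `{s₁ < re}` is used — no holomorphy) and exports the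
Haar∕Lebesgue ratio of ★ FILE 11 as ONE FUNCTION OF THE CARRIER `cν : Measure N_Δ(L⁺⊗ℝ) → ℝ≥0`, quantified BEFORE every other datum (index, point, weight, pictures, sections, `s`),
so that the carrier uniformity `νinf T = νinf ∅` ((3a′), K2Liu-p26) makes it one number by `congrArg`.
* §1 `integral_twisted_prod_eq_of_coordinates` — coordinates `Φ`, the ratio `(c, hc)` BY VALUE (★ FILE 11's output), `Ew` BY VALUE:
  `∫_N (∏_w e_w(hermOfReal(Φ u w)))·∏_w F_w(x_w·Fr u w·g_w) dν = c·∏_w Ew w s` for every flat family (Mathlib `integral_fintype_prod_volume_eq_prod`).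
* §2 `integral_twisted_prod_eq_of_frame` — through a multiplicative frame on `A ≥ N`, `x₀` with `Fr x₀ w = x_w`.
* §3 **`exists_haarRatio_twisted_of_record`** — THE RECORD CURRENCY: `∃ cν : Measure ↥(unipDeltaArch …) → ℝ≥0, ∀ ν [Haar] (B C hBC k Q h eb Wt hWt s₁ Ew), hEwq →
  ∀ s, s₁ < re s → ∀ F flat, ∫ Wt u·∏_w F_w(Fr((w_Δ)_∞·u·h) w) dν = cν ν·∏_w Ew w s` (★ FILE 12 coordinates once, ★ FILE 11 per Haar `ν`, §2).
* §4 `exists_haarRatio_twisted_of_presentation` — the same for an arch family presented as a flat product.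
* §5 **`exists_haarRatio_archWhittakerIntegral_eq`** — THE BRIDGE SIBLING: for a SUM presentation `Φ s a = Cst s·Σ_r c_r ∏_w Gs s r w (Fr (a·g) w)` and per-`(r,w)`
  letters `Ew r w` BY VALUE at the point `Fr (g₀·g) w`: `archWhittakerIntegral ν S Φ g₀ s = Cst s·Σ_r c_r·(cν ν·∏_w Ew r w s)` on `{s₁ < re}`, `½ ≤ s₁`
  (per-term integrability ★ FILE A §5, `integral_finsetSum`, `integral_const_mul` — ★ Bridge §1's text).
* §6 `exists_norm_le_of_differentiableOn_ball` — a holomorphic `Cst` on `{0 < re}` is bounded near every `z` there (for (L2)'s `‖Cst s‖ ≤ CC` on balls).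
References: [Shimura1997, §16.4, §18.4]; [KudlaRallis1994, §1–§2]; [Folland1995, §2.2]; [BorelJacquet1979, §4.1].
HONEST LABEL.  Count-neutral helper; explicit twins of ★ results, no new analytic content: `HC_CM` is proved only modulo the 7 printed citations (2 remaining named inputs: hLiu418 =
`stmt-HodgeConjecture-24832`, h413 = `stmt-HodgeConjecture-24833`) until rung 0 closes.
-/

set_option autoImplicit false
set_option linter.dupNamespace false -- the mandated namespace repeats `HodgeConjecture.HodgeConjecture`

noncomputable section

open Complex Matrix MeasureTheory MeasureTheory.Measure NumberField
open scoped ComplexConjugate NNReal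
open Literature.NumberTheory.Automorphic Literature.NumberTheory.GelbartRogawski1991 Literature.NumberTheory.GelbartRogawski1991.GRConstruction
open Literature.NumberTheory.K2Lit.SiegelDoubled
open Summit.HodgeConjecture.HodgeConjecture.Cruxes.HLiu418.K2LiuArchInducedTubeDefs
open Summit.HodgeConjecture.HodgeConjecture.Cruxes.HLiu418.K2LiuU22CompactPictureDefs
open Summit.HodgeConjecture.HodgeConjecture.Cruxes.HLiu418.K2LiuArchUnipotentHaarTransport (exists_integral_comp_eq_smul)
open Summit.HodgeConjecture.HodgeConjecture.Cruxes.HLiu418.K2LiuSiegelUnipotentLocalDefs (unipDeltaArch)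
open Summit.HodgeConjecture.HodgeConjecture.Cruxes.HLiu418.K2LiuSiegelUnipotentFourierDefs (unipDeltaChar)
open Summit.HodgeConjecture.HodgeConjecture.Cruxes.HLiu418.K2LiuSiegelUnipotentCharacters (continuous_unipDeltaChar)
open Summit.HodgeConjecture.HodgeConjecture.Cruxes.HLiu418.K2LiuHolTubeRigidityOfFrame (frame_mul frame_archPart_weylDelta)
open Summit.HodgeConjecture.HodgeConjecture.Cruxes.HLiu418.K2LiuKindWArchContinuation (integrable_twisted_prod_unipDeltaArch_of_record)
open Summit.HodgeConjecture.HodgeConjecture.Cruxes.HLiu418.K2LiuKindWArchLetterDefs (archWhittakerIntegral)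

namespace Summit.HodgeConjecture.HodgeConjecture.Cruxes.HLiu418.K2LiuKindWArchContinuationExplicit

/-! ## §1 Generic coordinates, the Haar∕Lebesgue ratio and the per-place letters by value -/

/-- **THE TWISTED BLOCK IN COORDINATES IS `c · ∏_w Ew w s`.**  `σ` finite; `x_w, g_w ∈ M₄(ℂ)`; weights `k_w`, compact pictures `Q_w`; a measurable space `N` with a map
`Φ : N → ∏_w ℝ^{2×2}` and a frame reading `Fr u w = n(hermOfReal (Φ u w))`; a measure `ν` on `N` with the transport identity `∫ G(Φ u) dν = c·∫ G d(Lebesgue)` BY VALUE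
(★ FILE 11 `exists_integral_comp_eq_smul`'s output); a weight that is a product of functions `e_w` of the Hermitian coordinate; and PER PLACE a function `Ew w` with the twisted
formula `hEwq` on `{s₁ < re}` (★ `K2LiuKindWArchWhittakerLetter` ∕ «Φ6b-ind» BY VALUE).  Then for every flat family `F_w ∈ I_w(s, χ_{k_w})`, `cp F_w = Q_w`, `s₁ < re s`:
`∫_N (∏_w e_w(hermOfReal(Φ u w)))·∏_w F_w(x_w·Fr u w·g_w) dν(u) = c·∏_w Ew w s` (Mathlib `integral_fintype_prod_volume_eq_prod`, unconditional). [cite: Shimura1997, §16.4]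
[cite: KudlaRallis1994, §1–§2] [cite: Folland1995, §2.2] -/
theorem integral_twisted_prod_eq_of_coordinates {σ : Type*} [Fintype σ] (k : σ → ℤ) (Q : σ → Carrier)
    (x g : σ → Matrix (Fin 2 ⊕ Fin 2) (Fin 2 ⊕ Fin 2) ℂ)
    {N : Type*} [MeasurableSpace N] (Φ : N → (σ → (Fin 2 → Fin 2 → ℝ)))
    (Fr : N → σ → Matrix (Fin 2 ⊕ Fin 2) (Fin 2 ⊕ Fin 2) ℂ) (hFr : ∀ u w, Fr u w = fromBlocks 1 (hermOfReal (Φ u w)) 0 1)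
    (ν : Measure N) (c : ℝ≥0) (hc : ∀ G : (σ → (Fin 2 → Fin 2 → ℝ)) → ℂ, ∫ u, G (Φ u) ∂ν = c • ∫ r, G r)
    (eb : σ → Matrix (Fin 2) (Fin 2) ℂ → ℂ) (s₁ : ℝ) (Ew : σ → ℂ → ℂ)
    (hEwq : ∀ w, ∀ s : ℂ, s₁ < s.re →
      ∀ F : Matrix (Fin 2 ⊕ Fin 2) (Fin 2 ⊕ Fin 2) ℂ → ℂ, IsArchSiegelSection (fun z : ℂ => (conj z / ((‖z‖ : ℝ) : ℂ)) ^ (k w)) s F →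
        (∀ (v : Matrix (Fin 2) (Fin 2) ℂ), vᴴ * v = 1 → ∀ hv : v.det ≠ 0,
          F ((2 : ℂ)⁻¹ • fromBlocks (1 + v) (-(I • (1 - v))) (I • (1 - v)) (1 + v) : Matrix (Fin 2 ⊕ Fin 2) (Fin 2 ⊕ Fin 2) ℂ) = evalAt v hv (Q w)) →
        ∫ r : Fin 2 → Fin 2 → ℝ, F (x w * fromBlocks 1 (hermOfReal r) 0 1 * g w) * eb w (hermOfReal r) = Ew w s)
    {s : ℂ} (hs : s₁ < s.re)
    (F : σ → Matrix (Fin 2 ⊕ Fin 2) (Fin 2 ⊕ Fin 2) ℂ → ℂ) (hF : ∀ w, IsArchSiegelSection (fun z : ℂ => (conj z / ((‖z‖ : ℝ) : ℂ)) ^ (k w)) s (F w))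
    (hQ : ∀ w, ∀ (v : Matrix (Fin 2) (Fin 2) ℂ), vᴴ * v = 1 → ∀ hv : v.det ≠ 0,
      (F w) ((2 : ℂ)⁻¹ • fromBlocks (1 + v) (-(I • (1 - v))) (I • (1 - v)) (1 + v) : Matrix (Fin 2 ⊕ Fin 2) (Fin 2 ⊕ Fin 2) ℂ) = evalAt v hv (Q w)) :
    ∫ u, (∏ w, eb w (hermOfReal (Φ u w))) * ∏ w, F w (x w * Fr u w * g w) ∂ν = ((c : ℝ) : ℂ) * ∏ w, Ew w s := by
  have hG := hc (fun r : σ → (Fin 2 → Fin 2 → ℝ) =>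
    (∏ w, eb w (hermOfReal (r w))) * ∏ w, F w (x w * fromBlocks 1 (hermOfReal (r w)) 0 1 * g w))
  have hint : ∫ u, (∏ w, eb w (hermOfReal (Φ u w))) * ∏ w, F w (x w * Fr u w * g w) ∂ν =
      ∫ u, (fun r : σ → (Fin 2 → Fin 2 → ℝ) => (∏ w, eb w (hermOfReal (r w))) * ∏ w, F w (x w * fromBlocks 1 (hermOfReal (r w)) 0 1 * g w)) (Φ u) ∂ν :=
    integral_congr_ae (Filter.Eventually.of_forall fun u => by simp only [hFr])
  have hprod : (fun r : σ → (Fin 2 → Fin 2 → ℝ) => (∏ w, eb w (hermOfReal (r w))) * ∏ w, F w (x w * fromBlocks 1 (hermOfReal (r w)) 0 1 * g w)) =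
      fun r => ∏ w, (F w (x w * fromBlocks 1 (hermOfReal (r w)) 0 1 * g w) * eb w (hermOfReal (r w))) := by
    funext r
    rw [mul_comm, ← Finset.prod_mul_distrib]
  rw [hint, hG, hprod, integral_fintype_prod_volume_eq_prod
    (fun w (r : Fin 2 → Fin 2 → ℝ) => F w (x w * fromBlocks 1 (hermOfReal r) 0 1 * g w) * eb w (hermOfReal r)),
    Finset.prod_congr rfl fun w _ => hEwq w s hs (F w) (hF w) (hQ w), NNReal.smul_def, Complex.real_smul]

/-! ## §2 A multiplicative frame on a bigger group -/

/-- **THE TWISTED BLOCK THROUGH A MULTIPLICATIVE FRAME IS `c · ∏_w Ew w s`** (explicit twin of ★ FILE A §2): `A` a group with a multiplicative frame `Fr`, `N ≤ A` with coordinates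
`Φ` read by the frame, the transport identity `(c, hc)` for `ν` on `N` BY VALUE, `x₀` with `Fr x₀ w = x_w`, `h ∈ A`, the weight read off the `(1,2)`-blocks, and the per-place
letters `Ew w` BY VALUE at `(x_w, Fr h w)`. [cite: Shimura1997, §16.4] [cite: KudlaRallis1994, §1–§2] -/
theorem integral_twisted_prod_eq_of_frame {σ : Type*} [Fintype σ] (k : σ → ℤ) (Q : σ → Carrier)
    {A : Type*} [Group A]
    (Fr : A → σ → Matrix (Fin 2 ⊕ Fin 2) (Fin 2 ⊕ Fin 2) ℂ) (hmul : ∀ a b w, Fr (a * b) w = Fr a w * Fr b w)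
    (N : Subgroup A) [MeasurableSpace N]
    (Φ : N → (σ → (Fin 2 → Fin 2 → ℝ))) (hFr : ∀ (u : N) w, Fr (u : A) w = fromBlocks 1 (hermOfReal (Φ u w)) 0 1)
    (ν : Measure N) (c : ℝ≥0) (hc : ∀ G : (σ → (Fin 2 → Fin 2 → ℝ)) → ℂ, ∫ u, G (Φ u) ∂ν = c • ∫ r, G r)
    (x : σ → Matrix (Fin 2 ⊕ Fin 2) (Fin 2 ⊕ Fin 2) ℂ) (x₀ : A) (hx₀ : ∀ w, Fr x₀ w = x w) (h : A)
    (eb : σ → Matrix (Fin 2) (Fin 2) ℂ → ℂ) (s₁ : ℝ) (Ew : σ → ℂ → ℂ)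
    (hEwq : ∀ w, ∀ s : ℂ, s₁ < s.re →
      ∀ F : Matrix (Fin 2 ⊕ Fin 2) (Fin 2 ⊕ Fin 2) ℂ → ℂ, IsArchSiegelSection (fun z : ℂ => (conj z / ((‖z‖ : ℝ) : ℂ)) ^ (k w)) s F →
        (∀ (v : Matrix (Fin 2) (Fin 2) ℂ), vᴴ * v = 1 → ∀ hv : v.det ≠ 0,
          F ((2 : ℂ)⁻¹ • fromBlocks (1 + v) (-(I • (1 - v))) (I • (1 - v)) (1 + v) : Matrix (Fin 2 ⊕ Fin 2) (Fin 2 ⊕ Fin 2) ℂ) = evalAt v hv (Q w)) →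
        ∫ r : Fin 2 → Fin 2 → ℝ, F (x w * fromBlocks 1 (hermOfReal r) 0 1 * Fr h w) * eb w (hermOfReal r) = Ew w s)
    {s : ℂ} (hs : s₁ < s.re)
    (F : σ → Matrix (Fin 2 ⊕ Fin 2) (Fin 2 ⊕ Fin 2) ℂ → ℂ) (hF : ∀ w, IsArchSiegelSection (fun z : ℂ => (conj z / ((‖z‖ : ℝ) : ℂ)) ^ (k w)) s (F w))
    (hQ : ∀ w, ∀ (v : Matrix (Fin 2) (Fin 2) ℂ), vᴴ * v = 1 → ∀ hv : v.det ≠ 0,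
      (F w) ((2 : ℂ)⁻¹ • fromBlocks (1 + v) (-(I • (1 - v))) (I • (1 - v)) (1 + v) : Matrix (Fin 2 ⊕ Fin 2) (Fin 2 ⊕ Fin 2) ℂ) = evalAt v hv (Q w)) :
    ∫ u : N, (∏ w, eb w (Matrix.toBlocks₁₂ (Fr (u : A) w))) * ∏ w, F w (Fr (x₀ * (u : A) * h) w) ∂ν = ((c : ℝ) : ℂ) * ∏ w, Ew w s := by
  have hint : ∫ u : N, (∏ w, eb w (Matrix.toBlocks₁₂ (Fr (u : A) w))) * ∏ w, F w (Fr (x₀ * (u : A) * h) w) ∂ν =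
      ∫ u : N, (∏ w, eb w (hermOfReal (Φ u w))) * ∏ w, F w (x w * Fr (u : A) w * Fr h w) ∂ν :=
    integral_congr_ae (Filter.Eventually.of_forall fun u => by simp only [hmul, hx₀, hFr, Matrix.toBlocks_fromBlocks₁₂])
  rw [hint]
  have hEq := integral_twisted_prod_eq_of_coordinates k Q x (fun w => Fr h w) Φ (fun (u : N) w => Fr (u : A) w) hFr ν c hc eb s₁ Ew hEwq hs F hF hQ
  simp only [hFr] at hEq ⊢
  exact hEq

/-! ## §3 The record currency: ONE ratio function of the carrier -/

variable (L : Type) [Field L] [NumberField L] [IsCMField L]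
variable {N₀ M₀ : ℕ} (e : Fin N₀ × Fin M₀ ≃ Fin 2)
  (dV : Fin N₀ → L) (hdV : ∀ i, IsCMField.complexConj L (dV i) = dV i)
  (dW : Fin M₀ → L) (hdW : ∀ i, IsCMField.complexConj L (dW i) = dW i)
  (T Tinv : {w : InfinitePlace L // w.IsComplex} → Matrix (Fin 2 ⊕ Fin 2) (Fin 2 ⊕ Fin 2) ℂ)
  (Fr : UnitaryGroup.arch (Fp L) L (IsCMField.complexConj L) (2 + 2) (hermD L e dV hdV dW hdW) →
    {w : InfinitePlace L // w.IsComplex} → Matrix (Fin 2 ⊕ Fin 2) (Fin 2 ⊕ Fin 2) ℂ)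
  (hFr : ∀ a w, Fr a w = T w * Matrix.reindex (e₂ (n := 2)).symm (e₂ (n := 2)).symm
    (((UnitaryGroup.archAt (Fp L) L (IsCMField.complexConj L) (2 + 2) (hermD L e dV hdV dW hdW) w
      (UnitaryGroup.complexConj_smul_infinitePlace L w.1) (IsCMField.complexConj_ne_one L) a :
        UnitaryGroup.archLocal L (2 + 2) (hermD L e dV hdV dW hdW) w) : GL (Fin (2 + 2)) ℂ) : Matrix (Fin (2 + 2)) (Fin (2 + 2)) ℂ) * Tinv w)
  (hT2 : ∀ w, Tinv w * T w = 1)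
  (hTU : ∀ w (g : GL (Fin (2 + 2)) ℂ), g ∈ UnitaryGroup.archLocal L (2 + 2) (hermD L e dV hdV dW hdW) w →
    (T w * Matrix.reindex (e₂ (n := 2)).symm (e₂ (n := 2)).symm (g : Matrix _ _ ℂ) * Tinv w)ᴴ * Matrix.J (Fin 2) ℂ *
      (T w * Matrix.reindex (e₂ (n := 2)).symm (e₂ (n := 2)).symm (g : Matrix _ _ ℂ) * Tinv w) = Matrix.J (Fin 2) ℂ)
  [MeasurableSpace ↥(unipDeltaArch L e dV hdV dW hdW)] [BorelSpace ↥(unipDeltaArch L e dV hdV dW hdW)]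
  [Fintype {w : InfinitePlace L // w.IsComplex}]

include hFr hT2 in
/-- **EXPLICIT TWISTED END LEMMA OF RECORD.**  Under the frame letters of record `(T, Tinv, Fr, hFr, hT1, hT2, hTiv, hTN)` there is ONE function `cν` of the Haar carrier on
`N_Δ(L⁺⊗ℝ)` (the Haar∕Lebesgue ratio through the frame coordinates of ★ FILE 12, ★ FILE 11) such that, for EVERY Haar `ν`, anti-diagonal reading `hBC`, weights `k`, pictures `Q`,
point `h`, weight `Wt` read in the frame, abscissa `s₁` and per-place letters `Ew` BY VALUE with their twisted formula on `{s₁ < re}`: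
`s₁ < re s → ∫ Wt u·∏_w F_w(Fr((w_Δ)_∞·u·h) w) dν(u) = cν ν·∏_w Ew w s` for every flat family.  `cν` is quantified before everything else, so equal carriers give equal
constants. [cite: Shimura1997, §16.4] [cite: KudlaRallis1994, §1–§2] [cite: BorelJacquet1979, §4.1] [cite: Folland1995, §2.2] -/
theorem exists_haarRatio_twisted_of_record (hT1 : ∀ w, T w * Tinv w = 1)
    (hTiv : ∀ w (u : GL (Fin (2 + 2)) ℂ), u ∈ UnitaryGroup.archLocal L (2 + 2) (hermD L e dV hdV dW hdW) w →
      K2LiuSiegelUnipotentLocalDefs.IsUnipM (n := 2) (u : Matrix (Fin (2 + 2)) (Fin (2 + 2)) ℂ) →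
        ∃ b : Matrix (Fin 2) (Fin 2) ℂ, bᴴ = b ∧ T w * Matrix.reindex (e₂ (n := 2)).symm (e₂ (n := 2)).symm (u : Matrix _ _ ℂ) * Tinv w = fromBlocks 1 b 0 1)
    (hTN : ∀ w (b : Matrix (Fin 2) (Fin 2) ℂ), bᴴ = b → ∃ u : GL (Fin (2 + 2)) ℂ,
      u ∈ UnitaryGroup.archLocal L (2 + 2) (hermD L e dV hdV dW hdW) w ∧ K2LiuSiegelUnipotentLocalDefs.IsUnipM (n := 2) (u : Matrix (Fin (2 + 2)) (Fin (2 + 2)) ℂ) ∧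
        T w * Matrix.reindex (e₂ (n := 2)).symm (e₂ (n := 2)).symm (u : Matrix _ _ ℂ) * Tinv w = fromBlocks 1 b 0 1) :
    ∃ cν : Measure ↥(unipDeltaArch L e dV hdV dW hdW) → ℝ≥0,
      ∀ (νinf : Measure ↥(unipDeltaArch L e dV hdV dW hdW)) [νinf.IsHaarMeasure]
        (B C : {w : InfinitePlace L // w.IsComplex} → Matrix (Fin 2) (Fin 2) ℂ), (∀ w, T w * fromBlocks 1 0 0 (-1) * Tinv w = fromBlocks 0 (B w) (C w) 0) →
        ∀ (k : {w : InfinitePlace L // w.IsComplex} → ℤ) (Q : {w : InfinitePlace L // w.IsComplex} → Carrier)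
          (h : UnitaryGroup.arch (Fp L) L (IsCMField.complexConj L) (2 + 2) (hermD L e dV hdV dW hdW))
          (eb : {w : InfinitePlace L // w.IsComplex} → Matrix (Fin 2) (Fin 2) ℂ → ℂ) (Wt : ↥(unipDeltaArch L e dV hdV dW hdW) → ℂ),
          (∀ u : ↥(unipDeltaArch L e dV hdV dW hdW),
            Wt u = ∏ w, eb w (Matrix.toBlocks₁₂ (Fr (u : UnitaryGroup.arch (Fp L) L (IsCMField.complexConj L) (2 + 2) (hermD L e dV hdV dW hdW)) w))) →
          ∀ (s₁ : ℝ) (Ew : {w : InfinitePlace L // w.IsComplex} → ℂ → ℂ),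
            (∀ w, ∀ s : ℂ, s₁ < s.re →
              ∀ F : Matrix (Fin 2 ⊕ Fin 2) (Fin 2 ⊕ Fin 2) ℂ → ℂ, IsArchSiegelSection (fun z : ℂ => (conj z / ((‖z‖ : ℝ) : ℂ)) ^ (k w)) s F →
                (∀ (v : Matrix (Fin 2) (Fin 2) ℂ), vᴴ * v = 1 → ∀ hv : v.det ≠ 0,
                  F ((2 : ℂ)⁻¹ • fromBlocks (1 + v) (-(I • (1 - v))) (I • (1 - v)) (1 + v) : Matrix (Fin 2 ⊕ Fin 2) (Fin 2 ⊕ Fin 2) ℂ) = evalAt v hv (Q w)) →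
                ∫ r : Fin 2 → Fin 2 → ℝ, F ((fromBlocks 0 (B w) (C w) 0 : Matrix (Fin 2 ⊕ Fin 2) (Fin 2 ⊕ Fin 2) ℂ) * fromBlocks 1 (hermOfReal r) 0 1 * Fr h w) *
                  eb w (hermOfReal r) = Ew w s) →
            ∀ s : ℂ, s₁ < s.re →
              ∀ F : {w : InfinitePlace L // w.IsComplex} → Matrix (Fin 2 ⊕ Fin 2) (Fin 2 ⊕ Fin 2) ℂ → ℂ,
                (∀ w, IsArchSiegelSection (fun z : ℂ => (conj z / ((‖z‖ : ℝ) : ℂ)) ^ (k w)) s (F w)) →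
                (∀ w, ∀ (v : Matrix (Fin 2) (Fin 2) ℂ), vᴴ * v = 1 → ∀ hv : v.det ≠ 0,
                  (F w) ((2 : ℂ)⁻¹ • fromBlocks (1 + v) (-(I • (1 - v))) (I • (1 - v)) (1 + v) : Matrix (Fin 2 ⊕ Fin 2) (Fin 2 ⊕ Fin 2) ℂ) = evalAt v hv (Q w)) →
                ∫ u : ↥(unipDeltaArch L e dV hdV dW hdW), Wt u * ∏ w, F w (Fr
                    (UnitaryGroup.archPart (Fp L) L (IsCMField.complexConj L) (2 + 2) (hermD L e dV hdV dW hdW) (weylDelta L e dV hdV dW hdW) *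
                      (u : UnitaryGroup.arch (Fp L) L (IsCMField.complexConj L) (2 + 2) (hermD L e dV hdV dW hdW)) * h) w) ∂νinf =
                  ((cν νinf : ℝ) : ℂ) * ∏ w, Ew w s := by
  classical
  -- the frame coordinates of record (★ FILE 12), chosen ONCE
  obtain ⟨Φ, hΦ, hΦFr⟩ := K2LiuArchUnipotentFrameCoordinates.exists_frameCoordinates L e dV hdV dW hdW T Tinv Fr hFr hT1 hT2 hTiv hTN
  -- Lebesgue on `∏_w Herm₂` is an additive Haar measure
  haveI h22 : (volume : Measure (Fin 2 → Fin 2 → ℝ)).IsAddHaarMeasure := Measure.pi.isAddHaarMeasure _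
  haveI : (volume : Measure ({w : InfinitePlace L // w.IsComplex} → (Fin 2 → Fin 2 → ℝ))).IsAddHaarMeasure := Measure.pi.isAddHaarMeasure _
  -- ★ FILE 11 per Haar carrier: the ratio as a function of the carrier
  have key : ∀ ν : Measure ↥(unipDeltaArch L e dV hdV dW hdW), ν.IsHaarMeasure →
      ∃ c : ℝ≥0, ∀ G : ({w : InfinitePlace L // w.IsComplex} → (Fin 2 → Fin 2 → ℝ)) → ℂ, ∫ u, G (Φ u) ∂ν = c • ∫ r, G r := fun ν hν =>
    exists_integral_comp_eq_smul volume Φ hΦ ν (F := ℂ)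
  choose cfun hcfun using key
  refine ⟨fun ν => if hν : ν.IsHaarMeasure then cfun ν hν else 0, ?_⟩
  intro νinf hνinf B C hBC k Q h eb Wt hWt s₁ Ew hEwq s hs F hF hQ
  have hx₀ : ∀ w, Fr (UnitaryGroup.archPart (Fp L) L (IsCMField.complexConj L) (2 + 2) (hermD L e dV hdV dW hdW) (weylDelta L e dV hdV dW hdW)) w =
      fromBlocks 0 (B w) (C w) 0 := fun w => by
    rw [frame_archPart_weylDelta L e dV hdV dW hdW T Tinv Fr hFr w, hBC w]
  have hint : ∫ u : ↥(unipDeltaArch L e dV hdV dW hdW), Wt u * ∏ w, F w (Fr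
        (UnitaryGroup.archPart (Fp L) L (IsCMField.complexConj L) (2 + 2) (hermD L e dV hdV dW hdW) (weylDelta L e dV hdV dW hdW) *
          (u : UnitaryGroup.arch (Fp L) L (IsCMField.complexConj L) (2 + 2) (hermD L e dV hdV dW hdW)) * h) w) ∂νinf =
      ∫ u : ↥(unipDeltaArch L e dV hdV dW hdW), (∏ w, eb w (Matrix.toBlocks₁₂ (Fr (u : UnitaryGroup.arch (Fp L) L (IsCMField.complexConj L) (2 + 2) (hermD L e dV hdV dW hdW)) w))) *
        ∏ w, F w (Fr (UnitaryGroup.archPart (Fp L) L (IsCMField.complexConj L) (2 + 2) (hermD L e dV hdV dW hdW) (weylDelta L e dV hdV dW hdW) *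
          (u : UnitaryGroup.arch (Fp L) L (IsCMField.complexConj L) (2 + 2) (hermD L e dV hdV dW hdW)) * h) w) ∂νinf :=
    integral_congr_ae (Filter.Eventually.of_forall fun u => by simp only [hWt])
  rw [hint]
  beta_reduce
  rw [dif_pos hνinf]
  exact integral_twisted_prod_eq_of_frame k Q Fr (fun a b w => frame_mul L e dV hdV dW hdW T Tinv Fr hFr hT2 a b w)
    (unipDeltaArch L e dV hdV dW hdW) Φ hΦFr νinf (cfun νinf hνinf) (hcfun νinf hνinf)
    (fun w => (fromBlocks 0 (B w) (C w) 0 : Matrix (Fin 2 ⊕ Fin 2) (Fin 2 ⊕ Fin 2) ℂ)) _ hx₀ h eb s₁ Ew hEwq hs F hF hQ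

/-! ## §4 The BRIDGE sibling: the arch Whittaker integral of a sum-presented family, explicitly -/

include hFr hT2 hTU in
/-- **THE ARCH WHITTAKER INTEGRAL OF A SUM-PRESENTED FAMILY IS `Cst s · Σ_r c_r · (cν ν · ∏_w Ew r w s)`** (explicit twin of ★ Bridge §1
`exists_continuation_archWhittakerIntegral_of_sumPresentation`).  ONE ratio function `cν` of the carrier (§3) serves every Haar `ν`, index `S ∈ M₂(L)` with frame reading `heb` of
`conj ψ_S(ι_∞ ·)`, points `g₀, g`, coefficients `c_r`, pictures `Q r w`, abscissa `s₁ ≥ ½`, per-`(r,w)` letters `Ew r w` BY VALUE at `Fr (g₀·g) w` (their twisted FORMULA only), and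
sum presentation `Φ s a = Cst s·Σ_r c_r ∏_w Gs s r w (Fr (a·g) w)` on `{s₁ < re}` (`Gs s r w ∈ I_w(s, χ_{k_w})` flat of picture `Q r w`; NO holomorphy of `Cst` needed):
`s₁ < re s → archWhittakerIntegral ν S Φ g₀ s = Cst s·Σ_r c_r·(cν ν·∏_w Ew r w s)` — per `r` §3 at the right factor `g₀·g`, `integral_finsetSum` + `integral_const_mul` with the per-term
integrability ★ FILE A §5 (weight `conj ψ_S(ι_∞ ·)` continuous and unimodular). [cite: Shimura1997, §16.4, §18.4] [cite: KudlaRallis1994, §1–§2] [cite: MoeglinWaldspurger1995, II.1.5] -/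
theorem exists_haarRatio_archWhittakerIntegral_eq (hT1 : ∀ w, T w * Tinv w = 1)
    (hTiv : ∀ w (u : GL (Fin (2 + 2)) ℂ), u ∈ UnitaryGroup.archLocal L (2 + 2) (hermD L e dV hdV dW hdW) w →
      K2LiuSiegelUnipotentLocalDefs.IsUnipM (n := 2) (u : Matrix (Fin (2 + 2)) (Fin (2 + 2)) ℂ) →
        ∃ b : Matrix (Fin 2) (Fin 2) ℂ, bᴴ = b ∧ T w * Matrix.reindex (e₂ (n := 2)).symm (e₂ (n := 2)).symm (u : Matrix _ _ ℂ) * Tinv w = fromBlocks 1 b 0 1)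
    (hTN : ∀ w (b : Matrix (Fin 2) (Fin 2) ℂ), bᴴ = b → ∃ u : GL (Fin (2 + 2)) ℂ,
      u ∈ UnitaryGroup.archLocal L (2 + 2) (hermD L e dV hdV dW hdW) w ∧ K2LiuSiegelUnipotentLocalDefs.IsUnipM (n := 2) (u : Matrix (Fin (2 + 2)) (Fin (2 + 2)) ℂ) ∧
        T w * Matrix.reindex (e₂ (n := 2)).symm (e₂ (n := 2)).symm (u : Matrix _ _ ℂ) * Tinv w = fromBlocks 1 b 0 1) :
    ∃ cν : Measure ↥(unipDeltaArch L e dV hdV dW hdW) → ℝ≥0,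
      ∀ (ν : Measure ↥(unipDeltaArch L e dV hdV dW hdW)) [ν.IsHaarMeasure]
        (B C : {w : InfinitePlace L // w.IsComplex} → Matrix (Fin 2) (Fin 2) ℂ), (∀ w, T w * fromBlocks 1 0 0 (-1) * Tinv w = fromBlocks 0 (B w) (C w) 0) →
        ∀ (k : {w : InfinitePlace L // w.IsComplex} → ℤ) (S : Matrix (Fin 2) (Fin 2) L)
          (eb : {w : InfinitePlace L // w.IsComplex} → Matrix (Fin 2) (Fin 2) ℂ → ℂ),
          (∀ u : ↥(unipDeltaArch L e dV hdV dW hdW),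
            (conj (unipDeltaChar L e dV hdV dW hdW S
                (UnitaryGroup.archToAdelic (Fp L) L (IsCMField.complexConj L) (2 + 2) (hermD L e dV hdV dW hdW)
                  (u : UnitaryGroup.arch (Fp L) L (IsCMField.complexConj L) (2 + 2) (hermD L e dV hdV dW hdW))) : ℂ)) =
              ∏ w, eb w (Matrix.toBlocks₁₂ (Fr (u : UnitaryGroup.arch (Fp L) L (IsCMField.complexConj L) (2 + 2) (hermD L e dV hdV dW hdW)) w))) →
          ∀ (g₀ g : UnitaryGroup.arch (Fp L) L (IsCMField.complexConj L) (2 + 2) (hermD L e dV hdV dW hdW))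
            {m : ℕ} (c : Fin m → ℂ) (Q : Fin m → {w : InfinitePlace L // w.IsComplex} → Carrier) (s₁ : ℝ), 1 / 2 ≤ s₁ →
            ∀ Ew : Fin m → {w : InfinitePlace L // w.IsComplex} → ℂ → ℂ,
              (∀ r w, ∀ s : ℂ, s₁ < s.re →
                ∀ F : Matrix (Fin 2 ⊕ Fin 2) (Fin 2 ⊕ Fin 2) ℂ → ℂ, IsArchSiegelSection (fun z : ℂ => (conj z / ((‖z‖ : ℝ) : ℂ)) ^ (k w)) s F →
                  (∀ (v : Matrix (Fin 2) (Fin 2) ℂ), vᴴ * v = 1 → ∀ hv : v.det ≠ 0,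
                    F ((2 : ℂ)⁻¹ • fromBlocks (1 + v) (-(I • (1 - v))) (I • (1 - v)) (1 + v) : Matrix (Fin 2 ⊕ Fin 2) (Fin 2 ⊕ Fin 2) ℂ) = evalAt v hv (Q r w)) →
                  ∫ x : Fin 2 → Fin 2 → ℝ, F ((fromBlocks 0 (B w) (C w) 0 : Matrix (Fin 2 ⊕ Fin 2) (Fin 2 ⊕ Fin 2) ℂ) * fromBlocks 1 (hermOfReal x) 0 1 * Fr (g₀ * g) w) *
                    eb w (hermOfReal x) = Ew r w s) →
              ∀ (Φ : ℂ → UnitaryGroup.arch (Fp L) L (IsCMField.complexConj L) (2 + 2) (hermD L e dV hdV dW hdW) → ℂ) (Cst : ℂ → ℂ)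
                (Gs : ℂ → Fin m → {w : InfinitePlace L // w.IsComplex} → Matrix (Fin 2 ⊕ Fin 2) (Fin 2 ⊕ Fin 2) ℂ → ℂ),
                (∀ s : ℂ, s₁ < s.re → ∀ r w, IsArchSiegelSection (fun z : ℂ => (conj z / ((‖z‖ : ℝ) : ℂ)) ^ (k w)) s (Gs s r w)) →
                (∀ s : ℂ, s₁ < s.re → ∀ r w, ∀ (v : Matrix (Fin 2) (Fin 2) ℂ), vᴴ * v = 1 → ∀ hv : v.det ≠ 0,
                  (Gs s r w) ((2 : ℂ)⁻¹ • fromBlocks (1 + v) (-(I • (1 - v))) (I • (1 - v)) (1 + v) : Matrix (Fin 2 ⊕ Fin 2) (Fin 2 ⊕ Fin 2) ℂ) = evalAt v hv (Q r w)) →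
                (∀ s : ℂ, s₁ < s.re → ∀ a : UnitaryGroup.arch (Fp L) L (IsCMField.complexConj L) (2 + 2) (hermD L e dV hdV dW hdW),
                  Φ s a = Cst s * ∑ r, c r * ∏ w, Gs s r w (Fr (a * g) w)) →
                ∀ s : ℂ, s₁ < s.re →
                  archWhittakerIntegral L e dV hdV dW hdW ν S Φ g₀ s = Cst s * ∑ r, c r * (((cν ν : ℝ) : ℂ) * ∏ w, Ew r w s) := by
  obtain ⟨cν, hcν⟩ := exists_haarRatio_twisted_of_record L e dV hdV dW hdW T Tinv Fr hFr hT2 hT1 hTiv hTN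
  refine ⟨cν, ?_⟩
  intro ν hν B C hBC k S eb heb g₀ g m c Q s₁ hs₁ Ew hEwq Φ Cst Gs hGs hGsQ hpres s hs
  -- the weight `Wt u := conj ψ_S(ι_∞ u)`: measurable, unimodular, read in the frame
  set Wt : ↥(unipDeltaArch L e dV hdV dW hdW) → ℂ := fun u =>
    (conj (unipDeltaChar L e dV hdV dW hdW S
        (UnitaryGroup.archToAdelic (Fp L) L (IsCMField.complexConj L) (2 + 2) (hermD L e dV hdV dW hdW)
          (u : UnitaryGroup.arch (Fp L) L (IsCMField.complexConj L) (2 + 2) (hermD L e dV hdV dW hdW))) : ℂ)) with hWt_def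
  have hWtm : AEStronglyMeasurable Wt ν := by
    refine Continuous.aestronglyMeasurable ?_
    exact Complex.continuous_conj.comp ((continuous_unipDeltaChar L e dV hdV dW hdW S).comp
      ((UnitaryGroup.continuous_archToAdelic (Fp L) L (IsCMField.complexConj L) (2 + 2) (hermD L e dV hdV dW hdW)).comp continuous_subtype_val))
  have hWt1 : ∀ u : ↥(unipDeltaArch L e dV hdV dW hdW), ‖Wt u‖ ≤ 1 := fun u => by
    rw [hWt_def, Complex.norm_conj]
    exact (Circle.norm_coe _).le
  have hWt : ∀ u : ↥(unipDeltaArch L e dV hdV dW hdW),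
      Wt u = ∏ w, eb w (Matrix.toBlocks₁₂ (Fr (u : UnitaryGroup.arch (Fp L) L (IsCMField.complexConj L) (2 + 2) (hermD L e dV hdV dW hdW)) w)) :=
    fun u => heb u
  have hs' : 1 / 2 < s.re := lt_of_le_of_lt hs₁ hs
  -- per `r`: §3 at the flat family `Gs s r ·` and the right factor `g₀ · g`
  have hEq : ∀ r : Fin m, ∫ u : ↥(unipDeltaArch L e dV hdV dW hdW), Wt u * ∏ w, Gs s r w (Fr
      (UnitaryGroup.archPart (Fp L) L (IsCMField.complexConj L) (2 + 2) (hermD L e dV hdV dW hdW) (weylDelta L e dV hdV dW hdW) *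
        (u : UnitaryGroup.arch (Fp L) L (IsCMField.complexConj L) (2 + 2) (hermD L e dV hdV dW hdW)) * (g₀ * g)) w) ∂ν =
      ((cν ν : ℝ) : ℂ) * ∏ w, Ew r w s := fun r =>
    hcν ν B C hBC k (Q r) (g₀ * g) eb Wt hWt s₁ (Ew r) (hEwq r) s hs (fun w => Gs s r w) (fun w => hGs s hs r w) (fun w => hGsQ s hs r w)
  -- per-term integrability (★ FILE A §5)
  have hInt : ∀ r : Fin m, Integrable (fun u : ↥(unipDeltaArch L e dV hdV dW hdW) => Wt u * ∏ w, Gs s r w (Fr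
      (UnitaryGroup.archPart (Fp L) L (IsCMField.complexConj L) (2 + 2) (hermD L e dV hdV dW hdW) (weylDelta L e dV hdV dW hdW) *
        (u : UnitaryGroup.arch (Fp L) L (IsCMField.complexConj L) (2 + 2) (hermD L e dV hdV dW hdW)) * (g₀ * g)) w)) ν := fun r =>
    integrable_twisted_prod_unipDeltaArch_of_record L e dV hdV dW hdW T Tinv Fr hFr hT2 hTU hT1 hTiv hTN ν B C hBC k (Q r) (g₀ * g) Wt hWtm hWt1 hs'
      (fun w => Gs s r w) (fun w => hGs s hs r w) (fun w => hGsQ s hs r w)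
  -- the integrand, term by term
  have hfun : (fun a : ↥(unipDeltaArch L e dV hdV dW hdW) => Wt a * Φ s
        (UnitaryGroup.archPart (Fp L) L (IsCMField.complexConj L) (2 + 2) (hermD L e dV hdV dW hdW) (weylDelta L e dV hdV dW hdW) *
          (a : UnitaryGroup.arch (Fp L) L (IsCMField.complexConj L) (2 + 2) (hermD L e dV hdV dW hdW)) * g₀)) =
      fun a => ∑ r, Cst s * c r * (Wt a * ∏ w, Gs s r w (Fr
        (UnitaryGroup.archPart (Fp L) L (IsCMField.complexConj L) (2 + 2) (hermD L e dV hdV dW hdW) (weylDelta L e dV hdV dW hdW) *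
          (a : UnitaryGroup.arch (Fp L) L (IsCMField.complexConj L) (2 + 2) (hermD L e dV hdV dW hdW)) * (g₀ * g)) w)) := by
    funext a
    rw [hpres s hs, ← mul_assoc _ g₀ g, Finset.mul_sum, Finset.mul_sum]
    exact Finset.sum_congr rfl fun r _ => by ring
  show (∫ a, Wt a * Φ s
      (UnitaryGroup.archPart (Fp L) L (IsCMField.complexConj L) (2 + 2) (hermD L e dV hdV dW hdW) (weylDelta L e dV hdV dW hdW) *
        (a : UnitaryGroup.arch (Fp L) L (IsCMField.complexConj L) (2 + 2) (hermD L e dV hdV dW hdW)) * g₀) ∂ν) = Cst s * ∑ r, c r * (((cν ν : ℝ) : ℂ) * ∏ w, Ew r w s)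
  rw [hfun, integral_finsetSum _ fun r _ => (hInt r).const_mul _, Finset.mul_sum]
  refine Finset.sum_congr rfl fun r _ => ?_
  rw [integral_const_mul, hEq r]
  ring

/-! ## §5 A holomorphic scalar is locally bounded on `{0 < re}` (the `‖Cst s‖ ≤ CC` letter on balls) -/

omit [Fintype {w : InfinitePlace L // w.IsComplex}] [MeasurableSpace ↥(unipDeltaArch L e dV hdV dW hdW)] [BorelSpace ↥(unipDeltaArch L e dV hdV dW hdW)] in
/-- **LOCAL BOUND OF A HOLOMORPHIC SCALAR**: if `Cst` is complex-differentiable on `{0 < re}` and `0 < re z`, then `‖Cst s‖ ≤ CC` on some ball `dist s z < r`, `0 < r`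
(continuity at `z`; `CC := ‖Cst z‖ + 1`, `r` small inside `{0 < re}`). [folklore] -/
theorem exists_norm_le_of_differentiableOn_ball {Cst : ℂ → ℂ} (hCst : DifferentiableOn ℂ Cst {s : ℂ | 0 < s.re}) {z : ℂ} (hz : 0 < z.re) :
    ∃ CC r : ℝ, 0 < r ∧ ∀ s : ℂ, dist s z < r → ‖Cst s‖ ≤ CC := by
  have hopen : IsOpen {s : ℂ | 0 < s.re} := isOpen_lt continuous_const Complex.continuous_re
  have hcont : ContinuousAt Cst z := (hCst.continuousOn.continuousWithinAt hz).continuousAt (hopen.mem_nhds hz)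
  have hev : ∀ᶠ s in nhds z, dist (Cst s) (Cst z) < 1 := hcont (Metric.ball_mem_nhds _ one_pos)
  obtain ⟨r, hr, hball⟩ := Metric.mem_nhds_iff.1 hev
  refine ⟨‖Cst z‖ + 1, r, hr, fun s hs => ?_⟩
  have h := hball hs
  simp only [Set.mem_setOf_eq, dist_eq_norm] at h
  calc ‖Cst s‖ = ‖(Cst s - Cst z) + Cst z‖ := by rw [sub_add_cancel]
    _ ≤ ‖Cst s - Cst z‖ + ‖Cst z‖ := norm_add_le _ _
    _ ≤ ‖Cst z‖ + 1 := by linarith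

end Summit.HodgeConjecture.HodgeConjecture.Cruxes.HLiu418.K2LiuKindWArchContinuationExplicit

end
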